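import Summits.BirchSwinnertonDyer.Statement
import Summits.BirchSwinnertonDyer.BirchSwinnertonDyer.Theorems.HigherGrossZagierDefs
import Literature.NumberTheory.EllipticCurves.GrossZagierRankOne
import Literature.NumberTheory.EllipticCurves.Heights
import Literature.NumberTheory.EllipticCurves.MordellWeil
import Literature.NumberTheory.EllipticCurves.AnalyticRank

/-!
# Route HigherGrossZagier — assembly and the rank-one datum (BirchSwinnertonDyer)

Target: `Summits/BirchSwinnertonDyer/Theorems/HigherGrossZagier/Assembly.lean`.

Two bookkeeping steps of route `BirchSwinnertonDyer/HigherGrossZagier`, both sorry-free: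

* `higherGZ_assembly` settles the assembly item stmt-BirchSwinnertonDyer-0500 (= the falsely
  closed twin -0259): the named facts `WeierstrassCurve.leadingLCoeff_ne_zero` and
  `WeierstrassCurve.hasEntireLFunction_rat` (AnalyticRank.lean), the Gram lemma (crux #5, taken as a
  hypothesis verbatim) and the thesis X (existence of a rank-`r_an` Gross–Zagier datum for every
  `E/ℚ` ∧ the upper bound `rank ≤ r_an`) imply `BirchSwinnertonDyer` (= `Literature.BSDRankConjecture`).
  Proof: `leadingLCoeff ≠ 0` and `leadingLCoeff = c · det` give `det ≠ 0`, the Gram lemma gives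
  `r_an ≤ rank`, the upper bound gives `rank ≤ r_an`.
* `higherGZ_rankOneDatum` settles stmt-BirchSwinnertonDyer-0524: the named fact
  `WeierstrassCurve.gross_zagier_rank_one_rat` (GrossZagierRankOne.lean; Gross–Zagier 1986
  Thm. I.6.3 + §V.2 with a non-vanishing twist) and the normalisation fact
  `WeierstrassCurve.Affine.Point.heightPairing_self` (`⟨P,P⟩ = ĥ P`, Heights.lean) give a
  `Literature.EllArith.HigherGrossZagierDatum W W.analyticRank` whenever `r_an(W) = 1` (the `1 × 1`
  regulator is `ĥ P`). Proof script due to grounder-ground-B-0 (note on the item, 2026-08-13).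

No analytic or arithmetic input beyond the quoted hypotheses is used.
-/

noncomputable section

namespace Literature.EllArith

open WeierstrassCurve WeierstrassCurve.Affine.Point

/-- Settles stmt-BirchSwinnertonDyer-0500 / -0259 (assembly of route HigherGrossZagier):
`leadingLCoeff_ne_zero` ∧ `hasEntireLFunction_rat` ∧ Gram lemma ∧ thesis X ⇒ `BirchSwinnertonDyer`.
[folklore] -/
theorem higherGZ_assembly :
    (∀ (W : WeierstrassCurve ℚ), W.leadingLCoeff_ne_zero) →
    WeierstrassCurve.hasEntireLFunction_rat →
    (∀ (W : WeierstrassCurve ℚ) [W.IsElliptic] (n : ℕ) (P : Fin n → W.toAffine.Point),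
      (Matrix.of fun i j => (P i).heightPairing (P j)).det ≠ 0 → n ≤ W.mordellWeilRank) →
    ((∀ (W : WeierstrassCurve ℚ) [W.IsElliptic],
        ∃ (P : Fin W.analyticRank → W.toAffine.Point) (c : ℝ), 0 < c ∧
          W.leadingLCoeff = ((c * (Matrix.of fun i j => (P i).heightPairing (P j)).det : ℝ) : ℂ)) ∧
      (∀ (W : WeierstrassCurve ℚ) [W.IsElliptic], W.mordellWeilRank ≤ W.analyticRank)) →
    BirchSwinnertonDyer := by
  intro hlead hent hgram hX
  obtain ⟨hcon, hub⟩ := hX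
  unfold BirchSwinnertonDyer Literature.BSDRankConjecture
  intro W hE
  obtain ⟨P, c, _hc, hL⟩ := hcon W
  have hne : W.leadingLCoeff ≠ 0 := hlead W (hent W)
  have hdet : (Matrix.of fun i j => (P i).heightPairing (P j)).det ≠ 0 := by
    intro h0
    apply hne
    rw [hL, h0, mul_zero, Complex.ofReal_zero]
  exact le_antisymm (hgram W W.analyticRank P hdet) (hub W)

/-- Settles stmt-BirchSwinnertonDyer-0524 (rank-one instance of the posited interface):
`gross_zagier_rank_one_rat` ∧ `heightPairing_self` ⇒ for `r_an(W) = 1` a rank-`r_an` Gross–Zagier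
datum exists (`P = ![P₁]`, same constant `c`). [folklore] -/
theorem higherGZ_rankOneDatum :
    WeierstrassCurve.gross_zagier_rank_one_rat →
    (∀ (V : WeierstrassCurve ℚ), @WeierstrassCurve.Affine.Point.heightPairing_self ℚ _ _ V) →
    ∀ (W : WeierstrassCurve ℚ) [W.IsElliptic], W.analyticRank = 1 →
      Nonempty (Literature.EllArith.HigherGrossZagierDatum W W.analyticRank) := by
  intro h1 h2 W _ hr
  obtain ⟨P, c, hc, hL⟩ := h1 W hr
  rw [hr]
  refine ⟨⟨![P], c, hc, ?_⟩⟩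
  have hL2 : iteratedDeriv 1 W.entireLFunction 1 / ((1 : ℕ).factorial : ℂ) =
      ((c * P.canonicalHeight : ℝ) : ℂ) := by
    have := hL
    simp only [WeierstrassCurve.leadingLCoeff, hr] at this
    simpa using this
  rw [hL2]
  congr 1
  rw [Matrix.det_fin_one]
  simp [h2 W P]

end Literature.EllArith

end
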